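import Summits.QuantumFields.GaugeBoot.SpatialLoopHankel
import Summits.QuantumFields.GaugeBoot.WilsonLoopRPMinors
import HarnessLib

/-!
# Gauge-boot / ym-instrument: the connected plaquette–plaquette correlator and its reflection-positivity minors

Cell `ym-instrument` (HUMAN RULING D-0084 (2); director-ym R138; HOME `run/shared/lean/pub/ym-instrument/`), crew (a),
Lean typist seat `ym-instrument-boot-lean-1`; file 3/3 (torus level) of the answer to the pre-registered question
**Q-A2 (α)** of `pub/ym-instrument/QUESTIONS.md` («positivity-only lower bound on the connected plaquette–plaquette
correlator decay at fixed β»; reading A-0826-9 = BOOT-PLAN §2 A-plan-2 / §5.1; run-list item R-A2.0, 0 core-h).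

HONEST FRAMING (page 1 of every file of this cell): no number, no certificate. EXACT inequalities between finitely
many lattice expectations of `SU(N)` lattice gauge theory (fundamental representation, STANDARD Wilson action at
`β_std = β`, tree coupling `β/N`) on the periodic lattice `(ℤ/L)^D`, `L` even, for plaquettes in a coordinate plane
`(i, j)` ORTHOGONAL to the separation axis `0` (`i, j ≠ 0`, `i ≠ j`, so `D ≥ 3`); any real `β` for the site
statements, `β ≥ 0` for the link statements. NOT a mass gap, NOT a continuum limit, NOT a string tension, no
`L → ∞` claim here (see `Instrument/PlaquettePairDecay`), nothing summit-bearing. LADDER CONSEQUENCE (registered): Q-A2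
informs the WCR cruxes `stmt-QuantumFields-19609` (`BulkDominatesColdBoxW`) / `19608` (`ColdBoxTwoPointFloorW`) and card
`cruxidea-stmt-QuantumFields-19354-5`; this file moves no number of any summit item.

## Content
* `plaquettePair ρ i j t` — the observable `u_P((0,0⃗); i, j) · u_P((t,0⃗); i, j)` (two parallel plaquettes at time
  separation `t`; `u_P = (1/N) Re tr ρ(U_P)`); `plaquettePair_eq` (= time correlator of the plaquette word).
* General `G`, `ρ`: the connected Hankel blocks `0 ≤ Σ_{a,b∈S} c_a c_b (⟨u_P(0) u_P((a+b)e₀)⟩ - ⟨u_P⟩²)` (`a ≤ L/2`,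
  any `β`; `hankel_plaquettePair_connected_nonneg_site`) and the shifted ones with `a+b+1` (`a + 1 ≤ L/2`, `β ≥ 0`;
  `hankel_plaquettePair_connected_nonneg_link`) — specialisations of `SpatialLoopHankel`.
* `SU(N)` at standard coupling: `plaquettePairCorrelator N D L β i j t = G_L(t)`,
  `plaquettePairConnected N D L β i j t = C_L(t) = G_L(t) - ⟨ū_P⟩²` (`plaquetteExpectation`; orbit average = local
  expectation, `plaquettePairConnected_eq`); the Hankel blocks `hankel_plaquettePairConnected_nonneg_site/link`; their
  diagonals `0 ≤ C_L(2a)` (`a ≤ L/2`), `0 ≤ C_L(2a+1)` (`a + 1 ≤ L/2`, `β ≥ 0`); the `2 × 2` minors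
  `C_L(a+b)² ≤ C_L(2a) C_L(2b)`, `C_L(a+b+1)² ≤ C_L(2a+1) C_L(2b+1)`; `|G_L| ≤ 1`, `C_L ≤ 1`.
* `limitPlaquettePairConnected N D μ i j t = C_μ(t)`: the same covariance in a state `μ` on configurations of `ℤ^D`
  (tree `plaquetteObs`), the object of the limit-point law.
On a FIXED torus nothing beyond heights `≤ L/2` is claimed (wrap-around: `C_L(t) = C_L(L - t)`); the decay LAW
(non-negative, antitone, log-convex, `C(t) ≥ C(0) (C(1)/C(0))^t`) holds at infinite-volume limit points and is the
Instrument file. References: Osterwalder–Seiler 1978 §2; Seiler LNP 159 Ch. 2; Montvay–Münster (1994) §3.2.6, (3.435);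
M. Lüscher, Comm. Math. Phys. 54 (1977) 283 (positivity of the transfer matrix — not needed here: both reflections
are used instead). Everything is `[folklore]`.
-/

noncomputable section

open MeasureTheory ComplexConjugate
open scoped ComplexOrder
open Literature.MathematicalPhysics.QuantumFieldTheory
open Literature.RepresentationTheory.CompactGroups

namespace Summit.QuantumFields.GaugeBoot

/-! ## The facing-plaquette pair -/

section PlaquettePair

variable {d L N : ℕ} [NeZero d] [NeZero L] {G : Type*} [Group G] [TopologicalSpace G]
  [IsTopologicalGroup G] [CompactSpace G] [MeasurableSpace G] [BorelSpace G]
  (ρ : G →* Matrix (Fin N) (Fin N) ℂ)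

/-- **The facing-plaquette pair observable** `u_P((0,0⃗); i, j) · u_P((t,0⃗); i, j)`: two parallel plaquettes in the
plane `(i, j)`, the second translated by `t` lattice units along the time axis `0` (`u_P = (1/N) Re tr ρ(U_P)`,
`plaquetteTrace`). Its expectation is the (disconnected) plaquette–plaquette correlator `G(t)`; the CONNECTED
correlator is `C(t) = G(t) - ⟨u_P⟩²`. [folklore] -/
def plaquettePair (i j : Fin d) (t : ℕ) (U : GaugeConfig d L G) : ℝ :=
  plaquetteTrace ρ 0 i j U * plaquetteTrace ρ (tSite (t : ℤ)) i j U

omit [NeZero L] [TopologicalSpace G] [IsTopologicalGroup G] [CompactSpace G] [MeasurableSpace G] [BorelSpace G] in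
/-- The plaquette pair is the time correlator of the plaquette word. [folklore] -/
theorem plaquettePair_eq (i j : Fin d) (t : ℕ) :
    plaquettePair (d := d) (L := L) (G := G) ρ i j t =
      fun U => wordLoop ρ 0 (Word.plaquette i j) U * wordLoop ρ (tSite (t : ℤ)) (Word.plaquette i j) U := by
  funext U; simp only [plaquettePair, wordLoop_plaquette]

/-- **Connected plaquette–plaquette correlator, site Hankel block (torus, exact).** For a compact group `G`,
continuous `ρ`, `L` even, ANY real `β`, a plane `(i, j)` with `i, j ≠ 0` (plaquettes orthogonal to the time
axis), heights `a ≤ L/2` (`a ∈ S`) and real `c_a`: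
`0 ≤ Σ_{a,b ∈ S} c_a c_b (⟨u_P(0) u_P((a+b) e₀)⟩_β - ⟨u_P⟩_β²)`. Osterwalder–Seiler site-reflection positivity
applied to `c₀ + Σ_a c_a u_P(a e₀)`, the constant optimised away. [folklore] -/
theorem hankel_plaquettePair_connected_nonneg_site (hL : Even L) (hρ : Continuous ρ) (β : ℝ) {i j : Fin d}
    (hi : i ≠ 0) (hj : j ≠ 0) (S : Finset ℕ) (hS : ∀ a ∈ S, a ≤ L / 2) (c : ℕ → ℝ) :
    0 ≤ ∑ a ∈ S, ∑ b ∈ S, c a * c b *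
      (wilsonExpectation ρ β (plaquettePair ρ i j (a + b) : GaugeConfig d L G → ℝ) -
        wilsonExpectation ρ β (plaquetteTrace ρ (0 : Site d L) i j) ^ 2) := by
  have h := hankel_wordLoop_connected_nonneg_site (G := G) ρ hL hρ β (Word.isSpatial_plaquette hi hj) S hS c
  simp only [plaquettePair_eq, ← wordLoop_plaquette]
  exact h

/-- **Connected plaquette–plaquette correlator, link Hankel block (torus, exact).** For `L` even, `β ≥ 0`,
`i, j ≠ 0`, heights `a + 1 ≤ L/2` and real `c_a`:
`0 ≤ Σ_{a,b ∈ S} c_a c_b (⟨u_P(0) u_P((a+b+1) e₀)⟩_β - ⟨u_P⟩_β²)` (reflection between time slices). [folklore] -/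
theorem hankel_plaquettePair_connected_nonneg_link (hL : Even L) (hρ : Continuous ρ) {β : ℝ} (hβ : 0 ≤ β)
    {i j : Fin d} (hi : i ≠ 0) (hj : j ≠ 0) (S : Finset ℕ) (hS : ∀ a ∈ S, a + 1 ≤ L / 2) (c : ℕ → ℝ) :
    0 ≤ ∑ a ∈ S, ∑ b ∈ S, c a * c b *
      (wilsonExpectation ρ β (plaquettePair ρ i j (a + b + 1) : GaugeConfig d L G → ℝ) -
        wilsonExpectation ρ β (plaquetteTrace ρ (0 : Site d L) i j) ^ 2) := by
  have h := hankel_wordLoop_connected_nonneg_link (G := G) ρ hL hρ hβ (Word.isSpatial_plaquette hi hj) S hS c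
  simp only [plaquettePair_eq, ← wordLoop_plaquette]
  exact h

end PlaquettePair

/-! ## `SU(N)` at standard Wilson coupling: the torus correlators `G_L(t)`, `C_L(t)` and their Hankel data -/

section StandardCoupling

/-- **`G_L(t) = ⟨u_P((0,0⃗); i, j) · u_P((t,0⃗); i, j)⟩_{(ℤ/L)^D, SU(N), β_std}`**: the facing-plaquette pair
correlator of `SU(N)` lattice gauge theory at STANDARD Wilson coupling `β_std = β` (tree coupling `β/N`,
`wilsonMeasure (suRep N) (β/N)`), plaquettes in the plane `(i, j)`, separation `t` along the axis `0`. [folklore] -/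
def plaquettePairCorrelator (N D L : ℕ) [NeZero D] [NeZero L] (β : ℝ) (i j : Fin D) (t : ℕ) : ℝ :=
  wilsonExpectation (suRep N) (β / N) (plaquettePair (suRep N) i j t : GaugeConfig D L (SU N) → ℝ)

/-- **`C_L(t) = G_L(t) - ⟨ū_P⟩²`**: the CONNECTED facing-plaquette pair correlator (covariance of two parallel
plaquettes at time separation `t`) of `SU(N)` at standard coupling on `(ℤ/L)^D` (`plaquetteExpectation` = the
torus-averaged plaquette, equal to `⟨u_P(x; i, j)⟩` for every plaquette by `OrbitAverages`). [folklore] -/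
def plaquettePairConnected (N D L : ℕ) [NeZero D] [NeZero L] (β : ℝ) (i j : Fin D) (t : ℕ) : ℝ :=
  plaquettePairCorrelator N D L β i j t - plaquetteExpectation N D L β ^ 2

variable {N D : ℕ} [NeZero D] (L : ℕ) [NeZero L]

/-- Unfolding: `C_L(t) = ⟨u_P(0) u_P(t e₀)⟩ - ⟨u_P(0; i, j)⟩²` (orbit average = local expectation, `i ≠ j`).
[folklore] -/
theorem plaquettePairConnected_eq (β : ℝ) {i j : Fin D} (hij : i ≠ j) (t : ℕ) :
    plaquettePairConnected N D L β i j t =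
      wilsonExpectation (suRep N) (β / N) (plaquettePair (suRep N) i j t : GaugeConfig D L (SU N) → ℝ) -
        wilsonExpectation (suRep N) (β / N) (plaquetteTrace (suRep N) (0 : Site D L) i j) ^ 2 := by
  rw [plaquettePairConnected, plaquettePairCorrelator, plaquetteExpectation,
    wilsonExpectation_meanPlaquette_eq_plaquetteTrace (suRep N) (continuous_suRep N) _ 0 hij]

/-- **Site Hankel block of `C_L`** (`SU(N)`, standard coupling, ANY real `β`, `L` even, plane `i ≠ j` orthogonal
to the time axis, heights `a ≤ L/2`): `0 ≤ Σ_{a,b ∈ S} c_a c_b C_L(a+b)`. EXACT torus statement. [folklore] -/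
theorem hankel_plaquettePairConnected_nonneg_site (hL : Even L) (β : ℝ) {i j : Fin D} (hi : i ≠ 0) (hj : j ≠ 0)
    (hij : i ≠ j) (S : Finset ℕ) (hS : ∀ a ∈ S, a ≤ L / 2) (c : ℕ → ℝ) :
    0 ≤ ∑ a ∈ S, ∑ b ∈ S, c a * c b * plaquettePairConnected N D L β i j (a + b) := by
  simp only [plaquettePairConnected_eq L β hij]
  exact hankel_plaquettePair_connected_nonneg_site (suRep N) hL (continuous_suRep N) (β / N) hi hj S hS c

/-- **Link Hankel block of `C_L`** (`β ≥ 0`, heights `a + 1 ≤ L/2`): `0 ≤ Σ_{a,b ∈ S} c_a c_b C_L(a+b+1)`.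
EXACT torus statement. [folklore] -/
theorem hankel_plaquettePairConnected_nonneg_link (hL : Even L) {β : ℝ} (hβ : 0 ≤ β) {i j : Fin D} (hi : i ≠ 0)
    (hj : j ≠ 0) (hij : i ≠ j) (S : Finset ℕ) (hS : ∀ a ∈ S, a + 1 ≤ L / 2) (c : ℕ → ℝ) :
    0 ≤ ∑ a ∈ S, ∑ b ∈ S, c a * c b * plaquettePairConnected N D L β i j (a + b + 1) := by
  simp only [plaquettePairConnected_eq L β hij]
  exact hankel_plaquettePair_connected_nonneg_link (suRep N) hL (continuous_suRep N)
    (div_nonneg hβ (Nat.cast_nonneg N)) hi hj S hS c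

/-- `0 ≤ C_L(2a)` for `a ≤ L/2` (diagonal of the site block; any real `β`). [folklore] -/
theorem plaquettePairConnected_nonneg_even (hL : Even L) (β : ℝ) {i j : Fin D} (hi : i ≠ 0) (hj : j ≠ 0)
    (hij : i ≠ j) {a : ℕ} (ha : a ≤ L / 2) : 0 ≤ plaquettePairConnected N D L β i j (a + a) := by
  have h := hankel_plaquettePairConnected_nonneg_site (N := N) L hL β hi hj hij {a} (by simpa using ha) fun _ => 1
  simpa using h

/-- `0 ≤ C_L(2a+1)` for `a + 1 ≤ L/2`, `β ≥ 0` (diagonal of the link block). [folklore] -/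
theorem plaquettePairConnected_nonneg_odd (hL : Even L) {β : ℝ} (hβ : 0 ≤ β) {i j : Fin D} (hi : i ≠ 0)
    (hj : j ≠ 0) (hij : i ≠ j) {a : ℕ} (ha : a + 1 ≤ L / 2) :
    0 ≤ plaquettePairConnected N D L β i j (a + a + 1) := by
  have h := hankel_plaquettePairConnected_nonneg_link (N := N) L hL hβ hi hj hij {a} (by simpa using ha) fun _ => 1
  simpa using h

/-- The site `2 × 2` minor: `C_L(a+b)² ≤ C_L(2a) · C_L(2b)` for `a, b ≤ L/2` (any real `β`). [folklore] -/
theorem plaquettePairConnected_sq_le_even (hL : Even L) (β : ℝ) {i j : Fin D} (hi : i ≠ 0) (hj : j ≠ 0)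
    (hij : i ≠ j) {a b : ℕ} (ha : a ≤ L / 2) (hb : b ≤ L / 2) :
    plaquettePairConnected N D L β i j (a + b) ^ 2 ≤
      plaquettePairConnected N D L β i j (a + a) * plaquettePairConnected N D L β i j (b + b) := by
  rcases eq_or_ne a b with rfl | hab
  · rw [sq]
  refine sq_le_mul_of_forall_quadratic_nonneg fun x => ?_
  have hS : ∀ e ∈ ({a, b} : Finset ℕ), e ≤ L / 2 := by
    intro e he
    simp only [Finset.mem_insert, Finset.mem_singleton] at he
    rcases he with rfl | rfl <;> omega
  have h := hankel_plaquettePairConnected_nonneg_site (N := N) L hL β hi hj hij {a, b} hS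
    (fun e => if e = a then x else 1)
  rw [Finset.sum_pair hab, Finset.sum_pair hab, Finset.sum_pair hab] at h
  simp only [↓reduceIte, hab.symm, Nat.add_comm b a] at h
  nlinarith [h]

/-- The link `2 × 2` minor: `C_L(a+b+1)² ≤ C_L(2a+1) · C_L(2b+1)` for `a + 1, b + 1 ≤ L/2`, `β ≥ 0`. [folklore] -/
theorem plaquettePairConnected_sq_le_odd (hL : Even L) {β : ℝ} (hβ : 0 ≤ β) {i j : Fin D} (hi : i ≠ 0)
    (hj : j ≠ 0) (hij : i ≠ j) {a b : ℕ} (ha : a + 1 ≤ L / 2) (hb : b + 1 ≤ L / 2) :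
    plaquettePairConnected N D L β i j (a + b + 1) ^ 2 ≤
      plaquettePairConnected N D L β i j (a + a + 1) * plaquettePairConnected N D L β i j (b + b + 1) := by
  rcases eq_or_ne a b with rfl | hab
  · rw [sq]
  refine sq_le_mul_of_forall_quadratic_nonneg fun x => ?_
  have hS : ∀ e ∈ ({a, b} : Finset ℕ), e + 1 ≤ L / 2 := by
    intro e he
    simp only [Finset.mem_insert, Finset.mem_singleton] at he
    rcases he with rfl | rfl <;> omega
  have h := hankel_plaquettePairConnected_nonneg_link (N := N) L hL hβ hi hj hij {a, b} hS
    (fun e => if e = a then x else 1)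
  rw [Finset.sum_pair hab, Finset.sum_pair hab, Finset.sum_pair hab] at h
  simp only [↓reduceIte, hab.symm, Nat.add_comm b a] at h
  nlinarith [h]

/-- `|G_L(t)| ≤ 1` (`|u_P| ≤ 1`). [folklore] -/
theorem abs_plaquettePairCorrelator_le_one (β : ℝ) (i j : Fin D) (t : ℕ) :
    |plaquettePairCorrelator N D L β i j t| ≤ 1 := by
  haveI := isProbabilityMeasure_wilsonMeasure (d := D) (L := L) (G := SU N) (suRep N) (continuous_suRep N) (β / N)
  have hbd : ∀ U : GaugeConfig D L (SU N), |plaquettePair (suRep N) i j t U| ≤ 1 := fun U => by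
    rw [plaquettePair, abs_mul]
    exact mul_le_one₀ (abs_plaquetteTrace_le_one _ (continuous_suRep N) _ _ _ U) (abs_nonneg _)
      (abs_plaquetteTrace_le_one _ (continuous_suRep N) _ _ _ U)
  unfold plaquettePairCorrelator wilsonExpectation
  calc |∫ U, plaquettePair (suRep N) i j t U ∂wilsonMeasure (suRep N) (β / N)|
      ≤ ∫ U, |plaquettePair (suRep N) i j t U| ∂wilsonMeasure (suRep N) (β / N) := abs_integral_le_integral_abs
    _ ≤ ∫ _U, (1 : ℝ) ∂wilsonMeasure (d := D) (L := L) (G := SU N) (suRep N) (β / N) :=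
        integral_mono_of_nonneg (ae_of_all _ fun U => abs_nonneg _) (integrable_const 1) (ae_of_all _ hbd)
    _ = 1 := by simp

/-- `C_L(t) ≤ 1`. [folklore] -/
theorem plaquettePairConnected_le_one (β : ℝ) (i j : Fin D) (t : ℕ) :
    plaquettePairConnected N D L β i j t ≤ 1 := by
  have h := (abs_le.1 (abs_plaquettePairCorrelator_le_one (N := N) L β i j t)).2
  have h2 := sq_nonneg (plaquetteExpectation N D L β)
  unfold plaquettePairConnected
  linarith

end StandardCoupling

/-! ## Infinite-volume limit points: the connected correlator `C_μ(t)` (definition, file 3/3) -/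

section LimitDef

open Literature.MathematicalPhysics.QuantumLattice (LGConfig plaquetteObs)

/-- **`C_μ(t)`**: the CONNECTED facing-plaquette correlator
`∫ u_P((0,0⃗); i, j) u_P((t,0⃗); i, j) dμ - (∫ u_P((0,0⃗); i, j) dμ)²` in a state `μ` on configurations of `ℤ^D`
(`u_P = (1/N) Re tr U_P`, tree `plaquetteObs`), for `SU(N)`; used at infinite-volume limit points of the torus
Wilson states (`IsInfiniteVolumeLimitAlong`). [folklore] -/
def limitPlaquettePairConnected (N D : ℕ) [NeZero D] (μ : Measure (LGConfig D (SU N))) (i j : Fin D) (t : ℕ) : ℝ :=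
  ∫ U, ((N : ℝ)⁻¹ * plaquetteObs (suRep N) 0 i j U) *
      ((N : ℝ)⁻¹ * plaquetteObs (suRep N) (Pi.single 0 (t : ℤ)) i j U) ∂μ -
    (∫ U, (N : ℝ)⁻¹ * plaquetteObs (suRep N) 0 i j U ∂μ) ^ 2

end LimitDef

end Summit.QuantumFields.GaugeBoot

end
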